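import Summits.QuantumFields.BalabanUV.Beta.EriceFlowEnclosureLogMeanClockIntegral
import Summits.QuantumFields.BalabanUV.Beta.EriceFlowEnclosureWeightedClockSampling

/-!
# Beta / EriceFlowEnclosureLogMeanClockIntegralLimit — THE TWO LOGARITHMIC AVERAGES ARE ONE: along ANY clock sequence `n·h_n → L₀ > 0` the
# LOGARITHMIC CUTOFF AVERAGE of a bounded, continuous, log-Lipschitz M sampled at the couplings (P2 #54e–#54g, discrete, uniform in `log n`)
# equals P2 #54j's LOG-SCALE AVERAGE at the current coupling (continuous, uniform in `log s`) up to o(1):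
#     **`(Σ_{n<N} M(h_n)∕(n+1))∕H_N − (∫_{h_N}^{c} M(s) ds∕s)∕log(c∕h_N) → 0`**   (0 < c < δ; this file: the ideal clock `h_n = L₀∕(n+1)`
# with the RATE `O(1∕log N)`, and the two reductions — two clocks, two points — that P2 #55c assembles for an arbitrary clock); in particular the two averages converge for the same M, along the same or
# different clocks, to the same limit or not at all.  So gen 37's two escapes (P2 #54g `logCutoffAverage_escapes`: samples `sin(log(n+1))`;
# P2 #54j `logScaleAverage_escapes`: `sin(log s)`) are ONE phenomenon, and gen 37's two Tauberian classes (power-scale slow decrease of the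
# samples, Móricz Cor. 3 in P2 #54i; of the function, Móricz Cor. 1) are one condition read on the two sides.  Pure [folklore]; by name over
# P2 #55a (`weightedSum_logIntegral_le`, `integral_div_abs_le`, masses), P2 #54e `logMean_of_tendsto`, P2 #53b (`logLip_abs`, `clock_tendsto_zero`),
# P2 #54g `escape_clock` (the ideal clock).
#   §1 TWO CLOCKS, ONE AVERAGE: `M(h_n) − M(h′_n) → 0` for two clocks with the same L₀, hence the two logarithmic cutoff averages differ by o(1)
#      (`logCutoffAverage_sub_tendsto_zero`) and converge together (`logCutoffAverage_clock_independent`);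
#   §2 THE IDEAL CLOCK WITH A RATE: `idealSum_eq` (reindexing), HEADLINE **`ideal_logCutoffAverage_rate`**
#      (`|S_N∕H_N − L(L₀∕(N+1))| ≤ K∕log(N+1)` for N ≥ N₁, with `L(t) = (∫_t^c M ds∕s)∕log(c∕t)`);
#   §3 THE LOG-SCALE AVERAGE MOVES SLOWLY: `logScale_two_point` (`|L t − L u| ≤ 2B·log(u∕t)∕log(c∕t)` for `0 < t ≤ u ≤ c∕e`) and its symmetric
#      crude form `logScale_two_point_abs` (`≤ 2B·|log(t∕u)|`).  The assembly along an ARBITRARY clock (two clocks + ideal clock + two points)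
#      and the passage to the full limit h → 0⁺ are P2 #55c.
# (β-flow team, prover 2 = lower ∕ positivity side, unit `b2b-balaban-beta-bflow-p2`, gen 38; module P2 #55b; no Erice sentence occurs)

HONEST FRAMING (page 1 of everything the β sub-cell writes): discharging `BetaPertH` makes Bałaban's UV stability UNCONDITIONAL — a
real constructive-QFT result; it is NOT the continuum limit and NOT the Clay problem.  HONEST DEPENDENCY (cell reorg 2026-08-19,
verbatim): «continuum YM on T⁴ ⇐ BetaPertH ∧ nine spine estimates (0/9 proved); BetaPertH ⇐ (D1) ∧ (D4) ∧ CAP+tail; G-an2-4 gates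
asym, D1 and NE2/3/4.»  THIS MODULE DISCHARGES NOTHING and quotes nothing: [folklore] real analysis (shapes: M = the three-loop Cesàro mean,
h = the cutoff couplings with the two-loop clock of row L119; Hardy, Divergent Series §§3.8, 4.16 — the second theorem of consistency for the
Riesz mean (R, log n, 1) and the logarithmic method (ℓ), here at 0⁺ in the coupling and along a perturbed clock).

THE POINT.  `Σ_{n<N} M(h_n)∕(n+1) = Σ_{n<N} (M(h_n) − M(L₀∕(n+1)))∕(n+1) + Σ_{k=1}^{N} M(L₀∕k)∕k`: the first is `H_N` times the ℓ-mean of a NULL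
sequence (two clocks), the second is `∫_{L₀∕(N+1)}^{c} M ds∕s + O(1)` (P2 #55a: the weighted cells have SUMMABLE errors), and
`H_N = log(c(N+1)∕L₀) + O(1) = log(c∕h_N) + o(log N)`; finally `L` moves by at most `2B·|log(t∕u)|∕log(c∕t)` between two small couplings,
and `L₀∕((N+1)h_N) → 1`.

WHAT THIS FILE PROVES (0 sorry, 0 def): §1 `clock_ratio_tendsto_one`, `sampled_sub_sampled_tendsto_zero`, **`logCutoffAverage_sub_tendsto_zero`**,
`logCutoffAverage_clock_independent`; §2 `idealSum_eq`, `intervalIntegrable_div`, HEADLINE **`ideal_logCutoffAverage_rate`**,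
END **`ideal_logCutoffAverage_sub_logScale_tendsto_zero`**; §3 `logScale_two_point`, `logScale_two_point_abs`.
NOT CLAIMED: the general-clock END and the passage from the clock sequence to the full limit h → 0⁺ (P2 #55c); a rate along a general clock (it
carries the clock rate `|log((N+1)h_N∕L₀)|` and the ℓ-mean of `C|log((n+1)h_n∕L₀)|` — not packaged); `BetaPertH`; continuum; Clay.
-/

namespace Summit.QuantumFields.BalabanUV.Beta.EriceFlowEnclosureLogMeanClockIntegralLimit

open Set Filter Topology MeasureTheory intervalIntegral
open Summit.QuantumFields.BalabanUV.Beta.EriceFlowEnclosureCesaroClockSampling (logLip_abs clock_tendsto_zero)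
open Summit.QuantumFields.BalabanUV.Beta.EriceFlowEnclosureLogMeanSeq (logMass_tendsto_atTop logMass_pos logMean_of_tendsto)
open Summit.QuantumFields.BalabanUV.Beta.EriceFlowEnclosureWeightedClockSampling (escape_clock)
open Summit.QuantumFields.BalabanUV.Beta.EriceFlowEnclosureLogMeanClockIntegral

noncomputable section

variable {M : ℝ → ℝ} {δ C B L₀ : ℝ}

/-! ## §1 Two clocks, one logarithmic cutoff average -/

/-- Two clocks with the same constant have ratio → 1: `n·h_n → L₀`, `n·h′_n → L₀`, L₀ > 0 ⟹ `h_n∕h′_n → 1`. [folklore] -/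
theorem clock_ratio_tendsto_one {h h' : ℕ → ℝ} (hL₀ : 0 < L₀)
    (hclock : Tendsto (fun n : ℕ => (n : ℝ) * h n) atTop (𝓝 L₀))
    (hclock' : Tendsto (fun n : ℕ => (n : ℝ) * h' n) atTop (𝓝 L₀)) :
    Tendsto (fun n => h n / h' n) atTop (𝓝 1) := by
  have h1 := hclock.div hclock' hL₀.ne'
  rw [div_self hL₀.ne'] at h1
  refine h1.congr' ?_
  filter_upwards [eventually_ge_atTop 1] with n hn
  have hn0 : (n : ℝ) ≠ 0 := Nat.cast_ne_zero.mpr (by omega)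
  simp only [Pi.div_apply]
  rw [mul_div_mul_left _ _ hn0]

/-- THE SAMPLES ALONG TWO CLOCKS DIFFER BY A NULL SEQUENCE: `|M(h_n) − M(h′_n)| ≤ C·|log(h_n∕h′_n)| → 0` (M log-Lipschitz on ]0, δ[, both
clocks positive with the same L₀ > 0). [folklore] -/
theorem sampled_sub_sampled_tendsto_zero (hδ : 0 < δ)
    (hlip : ∀ t u : ℝ, 0 < t → t ≤ u → u < δ → |M u - M t| ≤ C * Real.log (u / t))
    {h h' : ℕ → ℝ} (hpos : ∀ n, 0 < h n) (hpos' : ∀ n, 0 < h' n) (hL₀ : 0 < L₀)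
    (hclock : Tendsto (fun n : ℕ => (n : ℝ) * h n) atTop (𝓝 L₀))
    (hclock' : Tendsto (fun n : ℕ => (n : ℝ) * h' n) atTop (𝓝 L₀)) :
    Tendsto (fun n => M (h n) - M (h' n)) atTop (𝓝 0) := by
  have hlog : Tendsto (fun n : ℕ => Real.log (h n / h' n)) atTop (𝓝 0) := by
    have h2 := (Real.continuousAt_log one_ne_zero).tendsto.comp (clock_ratio_tendsto_one hL₀ hclock hclock')
    rwa [Real.log_one] at h2
  have hC0 : Tendsto (fun n : ℕ => C * |Real.log (h n / h' n)|) atTop (𝓝 0) := by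
    have h1 := (continuous_abs.tendsto 0).comp hlog
    rw [abs_zero] at h1
    have h2 := h1.const_mul C
    rwa [mul_zero] at h2
  have hbound : ∀ᶠ n in atTop, |M (h n) - M (h' n)| ≤ C * |Real.log (h n / h' n)| := by
    filter_upwards [(clock_tendsto_zero hclock).eventually (gt_mem_nhds hδ),
      (clock_tendsto_zero hclock').eventually (gt_mem_nhds hδ)] with n hn hn'
    exact logLip_abs hlip (hpos' n) hn' (hpos n) hn
  exact squeeze_zero_norm' (by filter_upwards [hbound] with n hn; rw [Real.norm_eq_abs]; exact hn) hC0

/-- **TWO CLOCKS, ONE LOGARITHMIC CUTOFF AVERAGE**: the logarithmic cutoff averages of the samples along two clocks with the same L₀ differ by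
the ℓ-mean of a null sequence, hence by o(1) (P2 #54e `logMean_of_tendsto`). [folklore] -/
theorem logCutoffAverage_sub_tendsto_zero (hδ : 0 < δ)
    (hlip : ∀ t u : ℝ, 0 < t → t ≤ u → u < δ → |M u - M t| ≤ C * Real.log (u / t))
    {h h' : ℕ → ℝ} (hpos : ∀ n, 0 < h n) (hpos' : ∀ n, 0 < h' n) (hL₀ : 0 < L₀)
    (hclock : Tendsto (fun n : ℕ => (n : ℝ) * h n) atTop (𝓝 L₀))
    (hclock' : Tendsto (fun n : ℕ => (n : ℝ) * h' n) atTop (𝓝 L₀)) :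
    Tendsto (fun N : ℕ =>
      (∑ n ∈ Finset.range N, ((n : ℝ) + 1)⁻¹ * M (h n)) / (∑ n ∈ Finset.range N, ((n : ℝ) + 1)⁻¹)
        - (∑ n ∈ Finset.range N, ((n : ℝ) + 1)⁻¹ * M (h' n)) / (∑ n ∈ Finset.range N, ((n : ℝ) + 1)⁻¹))
      atTop (𝓝 0) := by
  have hd := logMean_of_tendsto (sampled_sub_sampled_tendsto_zero hδ hlip hpos hpos' hL₀ hclock hclock')
  refine hd.congr fun N => ?_
  rw [← sub_div, ← Finset.sum_sub_distrib]
  congr 1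
  exact Finset.sum_congr rfl fun n _ => by ring

/-- COROLLARY: the logarithmic cutoff average converges along one clock iff along any other clock with the same L₀, to the same limit.
[folklore] -/
theorem logCutoffAverage_clock_independent (hδ : 0 < δ)
    (hlip : ∀ t u : ℝ, 0 < t → t ≤ u → u < δ → |M u - M t| ≤ C * Real.log (u / t))
    {h h' : ℕ → ℝ} (hpos : ∀ n, 0 < h n) (hpos' : ∀ n, 0 < h' n) (hL₀ : 0 < L₀)
    (hclock : Tendsto (fun n : ℕ => (n : ℝ) * h n) atTop (𝓝 L₀))
    (hclock' : Tendsto (fun n : ℕ => (n : ℝ) * h' n) atTop (𝓝 L₀)) (m : ℝ) :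
    Tendsto (fun N : ℕ => (∑ n ∈ Finset.range N, ((n : ℝ) + 1)⁻¹ * M (h n)) / (∑ n ∈ Finset.range N, ((n : ℝ) + 1)⁻¹))
        atTop (𝓝 m) ↔
      Tendsto (fun N : ℕ => (∑ n ∈ Finset.range N, ((n : ℝ) + 1)⁻¹ * M (h' n)) / (∑ n ∈ Finset.range N, ((n : ℝ) + 1)⁻¹))
        atTop (𝓝 m) := by
  have hD := logCutoffAverage_sub_tendsto_zero hδ hlip hpos hpos' hL₀ hclock hclock'
  constructor
  · intro h1
    have := h1.sub hD
    rw [sub_zero] at this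
    exact this.congr fun N => by ring
  · intro h2
    have := hD.add h2
    rw [zero_add] at this
    exact this.congr fun N => by ring

/-! ## §2 The ideal clock `L₀∕(n+1)`, with a rate -/

/-- Reindexing: `Σ_{n<N} f(L₀∕(n+1))∕(n+1) = Σ_{1 ≤ k < N+1} f(L₀∕k)∕k`. [folklore] -/
theorem idealSum_eq (f : ℝ → ℝ) (L₀ : ℝ) (N : ℕ) :
    ∑ n ∈ Finset.range N, ((n : ℝ) + 1)⁻¹ * f (L₀ / ((n : ℝ) + 1)) = ∑ k ∈ Finset.Ico 1 (N + 1), f (L₀ / k) / k := by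
  rw [Finset.sum_Ico_eq_sum_range, Nat.add_sub_cancel]
  refine Finset.sum_congr rfl fun n _ => ?_
  rw [Nat.cast_add, Nat.cast_one, add_comm (1:ℝ) (n:ℝ)]
  ring

/-- `s ↦ M(s)∕s` is interval integrable between any two points of ]0, δ[ when M is continuous there. [folklore] -/
theorem intervalIntegrable_div (hcont : ContinuousOn M (Ioo 0 δ)) {a b : ℝ} (ha : a ∈ Ioo 0 δ) (hb : b ∈ Ioo 0 δ) :
    IntervalIntegrable (fun s => M s / s) volume a b := by
  refine ((hcont.div continuousOn_id fun s hs => hs.1.ne').mono ?_).intervalIntegrable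
  intro s hs
  rcases le_total a b with hab | hba
  · rw [uIcc_of_le hab] at hs; exact ⟨ha.1.trans_le hs.1, hs.2.trans_lt hb.2⟩
  · rw [uIcc_of_ge hba] at hs; exact ⟨hb.1.trans_le hs.1, hs.2.trans_lt ha.2⟩

/-- **THE IDEAL CLOCK WITH A RATE (HEADLINE).**  M continuous on ]0, δ[, `|M| ≤ B`, `|M u − M t| ≤ C·log(u∕t)` (0 < t ≤ u < δ; C ≥ 0),
L₀ > 0, `0 < c < δ`.  Then there are K and N₁ with, for all N ≥ N₁,
**`|(Σ_{n<N} M(L₀∕(n+1))∕(n+1))∕H_N − (∫_{L₀∕(N+1)}^{c} M ds∕s)∕log(c(N+1)∕L₀)| ≤ K∕log(N+1)`** — the logarithmic cutoff average along the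
ideal clock IS the log-scale average at the current coupling, to O(1∕log N). [folklore] -/
theorem ideal_logCutoffAverage_rate (hδ : 0 < δ) (hL₀ : 0 < L₀) (hC : 0 ≤ C) (hcont : ContinuousOn M (Ioo 0 δ))
    (hlip : ∀ t u : ℝ, 0 < t → t ≤ u → u < δ → |M u - M t| ≤ C * Real.log (u / t))
    (hB : ∀ s ∈ Ioo 0 δ, |M s| ≤ B) {c : ℝ} (hc0 : 0 < c) (hcδ : c < δ) :
    ∃ K : ℝ, ∃ N₁ : ℕ, ∀ N : ℕ, N₁ ≤ N →
      |(∑ n ∈ Finset.range N, ((n : ℝ) + 1)⁻¹ * M (L₀ / ((n : ℝ) + 1))) / (∑ n ∈ Finset.range N, ((n : ℝ) + 1)⁻¹)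
          - (∫ s in (L₀ / ((N : ℝ) + 1))..c, M s / s) / Real.log (c / (L₀ / ((N : ℝ) + 1)))|
        ≤ K / Real.log ((N : ℝ) + 1) := by
  have hB0 : 0 ≤ B := (abs_nonneg _).trans (hB c ⟨hc0, hcδ⟩)
  -- the threshold k₀: L₀/k₀ < c
  obtain ⟨k₀, hk₀⟩ : ∃ k₀ : ℕ, k₀ = ⌈L₀ / c⌉₊ + 1 := ⟨_, rfl⟩
  have hk₀1 : 1 ≤ k₀ := by omega
  have hk₀pos : (0:ℝ) < k₀ := by exact_mod_cast lt_of_lt_of_le Nat.one_pos hk₀1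
  have hk₀c : L₀ / k₀ < c := by
    rw [div_lt_iff₀ hk₀pos]
    have h1 : L₀ / c ≤ ⌈L₀ / c⌉₊ := Nat.le_ceil _
    have h2 : ((⌈L₀ / c⌉₊ : ℕ) : ℝ) + 1 = k₀ := by rw [hk₀]; push_cast; ring
    rw [div_le_iff₀ hc0] at h1
    nlinarith
  have hk₀δ : L₀ / k₀ < δ := hk₀c.trans hcδ
  have hk₀mem : L₀ / k₀ ∈ Ioo 0 δ := ⟨div_pos hL₀ hk₀pos, hk₀δ⟩
  have hcmem : c ∈ Ioo 0 δ := ⟨hc0, hcδ⟩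
  -- constants
  set P : ℝ := ∑ k ∈ Finset.Ico 1 k₀, M (L₀ / k) / k with hP
  set D : ℝ := ∫ s in c..(L₀ / k₀), M s / s with hD
  refine ⟨|P| + 2 * (C + B) / k₀ + |D| + B * (|Real.log (c / L₀)| + 1), k₀, fun N hN => ?_⟩
  have hN1 : 1 ≤ N := hk₀1.trans hN
  have hNpos : (0:ℝ) < N := by exact_mod_cast lt_of_lt_of_le Nat.one_pos hN1
  have hN1pos : (0:ℝ) < (N:ℝ) + 1 := by positivity
  have hNk : k₀ ≤ N + 1 := by omega
  -- the current coupling t = L₀/(N+1)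
  set t : ℝ := L₀ / ((N : ℝ) + 1) with ht
  have ht0 : 0 < t := div_pos hL₀ hN1pos
  have htc' : t < c := by
    have h1 : t ≤ L₀ / k₀ := by
      rw [ht]; exact div_le_div_of_nonneg_left hL₀.le hk₀pos (by exact_mod_cast hNk)
    exact lt_of_le_of_lt h1 hk₀c
  have htmem : t ∈ Ioo 0 δ := ⟨ht0, htc'.trans hcδ⟩
  -- the sum: S = P + Q with Q over Ico k₀ (N+1)
  have hS : ∑ n ∈ Finset.range N, ((n : ℝ) + 1)⁻¹ * M (L₀ / ((n : ℝ) + 1))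
      = P + ∑ k ∈ Finset.Ico k₀ (N + 1), M (L₀ / k) / k := by
    rw [idealSum_eq, hP, Finset.sum_Ico_consecutive _ hk₀1 hNk]
  -- Q = ∫_t^{L₀/k₀} + E, |E| ≤ 2(C+B)/k₀
  have hE := weightedSum_logIntegral_le hδ hL₀ hC hcont hlip hB hk₀1 hk₀δ hNk
  rw [Nat.cast_succ, ← ht] at hE
  -- ∫_t^{L₀/k₀} = ∫_t^c + D
  have hsplitI : ∫ s in t..(L₀ / k₀), M s / s = (∫ s in t..c, M s / s) + D := by
    rw [hD, intervalIntegral.integral_add_adjacent_intervals (intervalIntegrable_div hcont htmem hcmem)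
      (intervalIntegrable_div hcont hcmem hk₀mem)]
  -- names
  set S : ℝ := ∑ n ∈ Finset.range N, ((n : ℝ) + 1)⁻¹ * M (L₀ / ((n : ℝ) + 1)) with hSdef
  set H : ℝ := ∑ n ∈ Finset.range N, ((n : ℝ) + 1)⁻¹ with hHdef
  set I : ℝ := ∫ s in t..c, M s / s with hIdef
  set Q : ℝ := ∑ k ∈ Finset.Ico k₀ (N + 1), M (L₀ / k) / k with hQdef
  set ℓ : ℝ := Real.log (c / t) with hℓdef
  have hH0 : 0 < H := logMass_pos hN1
  have hHlog : Real.log ((N:ℝ) + 1) ≤ H := log_succ_le_logMass N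
  have hlogN1 : 0 < Real.log ((N:ℝ) + 1) := Real.log_pos (by linarith)
  have hℓ0 : 0 < ℓ := Real.log_pos ((one_lt_div ht0).mpr htc')
  -- R := S − I, |R| ≤ |P| + 2(C+B)/k₀ + |D|
  have hR : |S - I| ≤ |P| + 2 * (C + B) / k₀ + |D| := by
    have hSI : S - I = P + D + (Q - ∫ s in t..(L₀ / k₀), M s / s) := by
      rw [hS, hsplitI]; ring
    rw [hSI]
    calc |P + D + (Q - ∫ s in t..(L₀ / k₀), M s / s)| ≤ |P + D| + |Q - ∫ s in t..(L₀ / k₀), M s / s| := abs_add_le _ _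
      _ ≤ |P| + |D| + 2 * (C + B) / k₀ := add_le_add (abs_add_le _ _) hE
      _ = |P| + 2 * (C + B) / k₀ + |D| := by ring
  -- |I| ≤ B ℓ
  have hI : |I| ≤ B * ℓ := integral_div_abs_le hB ht0 htc'.le hcδ
  -- |ℓ − H| ≤ |log(c/L₀)| + 1
  have hℓH : |ℓ - H| ≤ |Real.log (c / L₀)| + 1 := by
    have hℓeq : ℓ = Real.log (c / L₀) + Real.log ((N:ℝ) + 1) := by
      rw [hℓdef, ht, div_div_eq_mul_div, ← div_mul_eq_mul_div,
        Real.log_mul (div_pos hc0 hL₀).ne' hN1pos.ne']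
    have hH1 : H ≤ 1 + Real.log ((N:ℝ) + 1) :=
      (logMass_le_one_add_log N).trans (by linarith [Real.log_le_log hNpos (by linarith : (N:ℝ) ≤ N + 1)])
    rw [hℓeq, abs_le]
    constructor
    · linarith [neg_abs_le (Real.log (c / L₀))]
    · linarith [le_abs_self (Real.log (c / L₀))]
  -- the identity S/H − I/ℓ = (S − I)/H + I(ℓ − H)/(Hℓ)
  have hkey : S / H - I / ℓ = (S - I) / H + I * (ℓ - H) / (H * ℓ) := by
    field_simp
    ring
  rw [hkey]
  have h1 : |(S - I) / H| ≤ (|P| + 2 * (C + B) / k₀ + |D|) / H := by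
    rw [abs_div, abs_of_pos hH0]; exact div_le_div_of_nonneg_right hR hH0.le
  have h2 : |I * (ℓ - H) / (H * ℓ)| ≤ B * (|Real.log (c / L₀)| + 1) / H := by
    rw [abs_div, abs_mul, abs_of_pos (mul_pos hH0 hℓ0)]
    calc |I| * |ℓ - H| / (H * ℓ) ≤ B * ℓ * (|Real.log (c / L₀)| + 1) / (H * ℓ) :=
          div_le_div_of_nonneg_right (mul_le_mul hI hℓH (abs_nonneg _) (by positivity)) (by positivity)
      _ = B * (|Real.log (c / L₀)| + 1) / H := by field_simp
  have hK0 : 0 ≤ |P| + 2 * (C + B) / k₀ + |D| + B * (|Real.log (c / L₀)| + 1) := by positivity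
  calc |(S - I) / H + I * (ℓ - H) / (H * ℓ)| ≤ |(S - I) / H| + |I * (ℓ - H) / (H * ℓ)| := abs_add_le _ _
    _ ≤ (|P| + 2 * (C + B) / k₀ + |D|) / H + B * (|Real.log (c / L₀)| + 1) / H := add_le_add h1 h2
    _ = (|P| + 2 * (C + B) / k₀ + |D| + B * (|Real.log (c / L₀)| + 1)) / H := by ring
    _ ≤ (|P| + 2 * (C + B) / k₀ + |D| + B * (|Real.log (c / L₀)| + 1)) / Real.log ((N:ℝ) + 1) :=
        div_le_div_of_nonneg_left hK0 hlogN1 hHlog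

/-- COROLLARY: along the ideal clock the logarithmic cutoff average minus the log-scale average at the current coupling tends to 0. [folklore] -/
theorem ideal_logCutoffAverage_sub_logScale_tendsto_zero (hδ : 0 < δ) (hL₀ : 0 < L₀) (hC : 0 ≤ C)
    (hcont : ContinuousOn M (Ioo 0 δ))
    (hlip : ∀ t u : ℝ, 0 < t → t ≤ u → u < δ → |M u - M t| ≤ C * Real.log (u / t))
    (hB : ∀ s ∈ Ioo 0 δ, |M s| ≤ B) {c : ℝ} (hc0 : 0 < c) (hcδ : c < δ) :
    Tendsto (fun N : ℕ =>
      (∑ n ∈ Finset.range N, ((n : ℝ) + 1)⁻¹ * M (L₀ / ((n : ℝ) + 1))) / (∑ n ∈ Finset.range N, ((n : ℝ) + 1)⁻¹)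
        - (∫ s in (L₀ / ((N : ℝ) + 1))..c, M s / s) / Real.log (c / (L₀ / ((N : ℝ) + 1)))) atTop (𝓝 0) := by
  obtain ⟨K, N₁, hK⟩ := ideal_logCutoffAverage_rate hδ hL₀ hC hcont hlip hB hc0 hcδ
  have hlog : Tendsto (fun N : ℕ => Real.log ((N:ℝ) + 1)) atTop atTop :=
    Real.tendsto_log_atTop.comp (tendsto_natCast_atTop_atTop.atTop_add tendsto_const_nhds)
  have hK0 : Tendsto (fun N : ℕ => |K| / Real.log ((N:ℝ) + 1)) atTop (𝓝 0) := tendsto_const_nhds.div_atTop hlog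
  refine squeeze_zero_norm' ?_ hK0
  filter_upwards [eventually_ge_atTop N₁, eventually_ge_atTop 1] with N hN hN1
  rw [Real.norm_eq_abs]
  have hlogpos : 0 < Real.log ((N:ℝ) + 1) := Real.log_pos (by
    have : (1:ℝ) ≤ N := by exact_mod_cast hN1
    linarith)
  exact (hK N hN).trans (div_le_div_of_nonneg_right (le_abs_self K) hlogpos.le)

/-! ## §3 The log-scale average moves slowly between two small couplings -/

/-- **TWO-POINT ESTIMATE**: M continuous on ]0, δ[ with `|M| ≤ B`, `c < δ`, and `0 < t ≤ u ≤ c∕e`.  With `L(x) = (∫_x^c M ds∕s)∕log(c∕x)`: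
**`|L t − L u| ≤ 2B·log(u∕t)∕log(c∕t)`** — `L t − L u = (∫_t^u M∕s)∕ℓ_t + I_u·(ℓ_u − ℓ_t)∕(ℓ_t ℓ_u)` with `|∫_t^u M∕s| ≤ B log(u∕t)`,
`|I_u| ≤ B ℓ_u`, `ℓ_t − ℓ_u = log(u∕t)`. [folklore] -/
theorem logScale_two_point (hcont : ContinuousOn M (Ioo 0 δ)) (hB : ∀ s ∈ Ioo 0 δ, |M s| ≤ B)
    {c t u : ℝ} (hcδ : c < δ) (ht : 0 < t) (htu : t ≤ u) (huc : u ≤ c * Real.exp (-1)) :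
    |(∫ s in t..c, M s / s) / Real.log (c / t) - (∫ s in u..c, M s / s) / Real.log (c / u)|
      ≤ 2 * B * Real.log (u / t) / Real.log (c / t) := by
  have hu0 : 0 < u := ht.trans_le htu
  have hc0 : 0 < c := by
    by_contra hc
    rw [not_lt] at hc
    have : c * Real.exp (-1) ≤ 0 := mul_nonpos_of_nonpos_of_nonneg hc (Real.exp_pos _).le
    linarith
  have huc' : u < c := by
    have he : Real.exp (-1) < 1 := Real.exp_lt_one_iff.mpr (by norm_num)
    have : c * Real.exp (-1) < c * 1 := mul_lt_mul_of_pos_left he hc0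
    linarith
  have htc : t < c := lt_of_le_of_lt htu huc'
  have hB0 : 0 ≤ B := (abs_nonneg _).trans (hB u ⟨hu0, huc'.trans hcδ⟩)
  have hℓu : 1 ≤ Real.log (c / u) := by
    rw [Real.le_log_iff_exp_le (div_pos hc0 hu0), le_div_iff₀ hu0]
    calc Real.exp 1 * u ≤ Real.exp 1 * (c * Real.exp (-1)) := mul_le_mul_of_nonneg_left huc (Real.exp_pos 1).le
      _ = c := by rw [mul_comm, mul_assoc, ← Real.exp_add, neg_add_cancel, Real.exp_zero, mul_one]
  have hℓtu : Real.log (c / u) ≤ Real.log (c / t) :=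
    Real.log_le_log (div_pos hc0 hu0) (div_le_div_of_nonneg_left hc0.le ht htu)
  set ℓt : ℝ := Real.log (c / t) with hℓt
  set ℓu : ℝ := Real.log (c / u) with hℓu'
  have hℓt0 : 0 < ℓt := lt_of_lt_of_le one_pos (hℓu.trans hℓtu)
  have hℓu0 : 0 < ℓu := lt_of_lt_of_le one_pos hℓu
  have hlog_ut : 0 ≤ Real.log (u / t) := Real.log_nonneg ((one_le_div ht).mpr htu)
  have htmem : t ∈ Ioo 0 δ := ⟨ht, htc.trans hcδ⟩
  have humem : u ∈ Ioo 0 δ := ⟨hu0, huc'.trans hcδ⟩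
  have hcmem : c ∈ Ioo 0 δ := ⟨hc0, hcδ⟩
  set Iu : ℝ := ∫ s in u..c, M s / s with hIu'
  set J : ℝ := ∫ s in t..u, M s / s with hJ'
  have hadd : ∫ s in t..c, M s / s = J + Iu :=
    (intervalIntegral.integral_add_adjacent_intervals (intervalIntegrable_div hcont htmem humem)
      (intervalIntegrable_div hcont humem hcmem)).symm
  have hJ : |J| ≤ B * Real.log (u / t) := integral_div_abs_le hB ht htu (huc'.trans hcδ)
  have hIu : |Iu| ≤ B * ℓu := integral_div_abs_le hB hu0 huc'.le hcδ
  have hℓdiff : ℓt - ℓu = Real.log (u / t) := by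
    rw [hℓt, hℓu', Real.log_div hc0.ne' ht.ne', Real.log_div hc0.ne' hu0.ne', Real.log_div hu0.ne' ht.ne']; ring
  have hkey : (J + Iu) / ℓt - Iu / ℓu = J / ℓt - Iu * Real.log (u / t) / (ℓt * ℓu) := by
    rw [← hℓdiff]; field_simp; ring
  rw [hadd, hkey]
  have h1 : |J / ℓt| ≤ B * Real.log (u / t) / ℓt := by
    rw [abs_div, abs_of_pos hℓt0]; exact div_le_div_of_nonneg_right hJ hℓt0.le
  have h2 : |Iu * Real.log (u / t) / (ℓt * ℓu)| ≤ B * Real.log (u / t) / ℓt := by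
    rw [abs_div, abs_mul, abs_of_nonneg hlog_ut, abs_of_pos (mul_pos hℓt0 hℓu0)]
    calc |Iu| * Real.log (u / t) / (ℓt * ℓu) ≤ B * ℓu * Real.log (u / t) / (ℓt * ℓu) :=
          div_le_div_of_nonneg_right (mul_le_mul_of_nonneg_right hIu hlog_ut) (by positivity)
      _ = B * Real.log (u / t) / ℓt := by field_simp
  calc |J / ℓt - Iu * Real.log (u / t) / (ℓt * ℓu)| ≤ |J / ℓt| + |Iu * Real.log (u / t) / (ℓt * ℓu)| := abs_sub _ _
    _ ≤ B * Real.log (u / t) / ℓt + B * Real.log (u / t) / ℓt := add_le_add h1 h2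
    _ = 2 * B * Real.log (u / t) / ℓt := by ring

/-- Symmetric crude form: for `a, b ∈ ]0, c∕e]` (c < δ): `|L a − L b| ≤ 2B·|log(a∕b)|` (the denominator `log(c∕min) ≥ 1` is dropped). [folklore] -/
theorem logScale_two_point_abs (hcont : ContinuousOn M (Ioo 0 δ)) (hB : ∀ s ∈ Ioo 0 δ, |M s| ≤ B)
    {c a b : ℝ} (hcδ : c < δ) (ha : 0 < a) (hac : a ≤ c * Real.exp (-1)) (hb : 0 < b) (hbc : b ≤ c * Real.exp (-1)) :
    |(∫ s in a..c, M s / s) / Real.log (c / a) - (∫ s in b..c, M s / s) / Real.log (c / b)|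
      ≤ 2 * B * |Real.log (a / b)| := by
  have hc0 : 0 < c := by
    by_contra hc
    rw [not_lt] at hc
    have : c * Real.exp (-1) ≤ 0 := mul_nonpos_of_nonpos_of_nonneg hc (Real.exp_pos _).le
    linarith
  have hce : c * Real.exp (-1) < c := by
    have he : Real.exp (-1) < 1 := Real.exp_lt_one_iff.mpr (by norm_num)
    have : c * Real.exp (-1) < c * 1 := mul_lt_mul_of_pos_left he hc0
    linarith
  have hB0 : 0 ≤ B := (abs_nonneg _).trans (hB a ⟨ha, (hac.trans_lt hce).trans hcδ⟩)
  -- log(c/x) ≥ 1 for x ≤ c/e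
  have hℓ1 : ∀ x : ℝ, 0 < x → x ≤ c * Real.exp (-1) → 1 ≤ Real.log (c / x) := by
    intro x hx hxc
    rw [Real.le_log_iff_exp_le (div_pos hc0 hx), le_div_iff₀ hx]
    calc Real.exp 1 * x ≤ Real.exp 1 * (c * Real.exp (-1)) := mul_le_mul_of_nonneg_left hxc (Real.exp_pos 1).le
      _ = c := by rw [mul_comm, mul_assoc, ← Real.exp_add, neg_add_cancel, Real.exp_zero, mul_one]
  rcases le_total a b with hab | hba
  · have h := logScale_two_point hcont hB hcδ ha hab hbc
    have hl : 0 ≤ Real.log (b / a) := Real.log_nonneg ((one_le_div ha).mpr hab)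
    have hden := hℓ1 a ha hac
    have hlog : |Real.log (a / b)| = Real.log (b / a) := by
      rw [← inv_div, Real.log_inv, abs_neg, abs_of_nonneg hl]
    rw [hlog]
    refine h.trans ?_
    rw [div_le_iff₀ (lt_of_lt_of_le one_pos hden)]
    have : 0 ≤ 2 * B * Real.log (b / a) := by positivity
    nlinarith
  · have h := logScale_two_point hcont hB hcδ hb hba hac
    have hl : 0 ≤ Real.log (a / b) := Real.log_nonneg ((one_le_div hb).mpr hba)
    have hden := hℓ1 b hb hbc
    rw [abs_sub_comm, abs_of_nonneg hl]
    refine h.trans ?_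
    rw [div_le_iff₀ (lt_of_lt_of_le one_pos hden)]
    have : 0 ≤ 2 * B * Real.log (a / b) := by positivity
    nlinarith

end

end Summit.QuantumFields.BalabanUV.Beta.EriceFlowEnclosureLogMeanClockIntegralLimit
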